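import Summits.RiemannHypothesis.RiemannHypothesis.Theorems.TiltedLandingLaw421R3LimitMenu

/-!
# «FlatMenuBBChecker» (W-08 C1, rh-idea-5 g42; module 1 of 4 of «FlatMenuBB», form of record (CA1206)(2))

The flat reads of the E5 package PH `(J0, D0, g0) = (9/2, 1, 9/25)` (`asecF`, `ahpX`/`ahpF`, `thpF`, `MenuFlatPH`; over #1314's `kap`, `limW`)
and the REFLECTIVE exact-rational branch-and-bound CHECKER `bb` (fractions `num/(pden+1)`, boxes clamped to `[0,1] × [1,∞)`), with the
semantics lemmas (`Frac.toR`, `toR_add/sub/mul/min/max`, `leB_iff`, `eight_div_le`, `limMu_le_muHi`) that module 3 («FlatMenuBBSound») uses.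
Module 2 («FlatMenuBBCert») evaluates `bb 60 0 1 1 171` in the kernel; module 4 («FlatMenuBBDoors») assembles `MenuFlatPH` and the
flat trichotomy `FlatDoors3Sig (9/2) 1 (9/25)` of #1323/«MenuThinLeaf».
Nothing here bears on the truth of RH; RH is not proved (this is a SUPPORT computation for the E5 leaf of the W-08 sink line, not the crux).
-/

namespace RhW08.FlatMenuBB
open RhW08.LimitMenu

section FlatDefs
/-! ## §0 The flat reads (C1 «LimitMenuRooms» v3 §1–§2, re-homed in this namespace) -/
/-- `ι²·E`. -/
noncomputable def limI (Q r : ℝ) : ℝ := r * (r - 1) ^ 2 * (1 - Q) ^ 2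
/-- `k²·E`. -/
noncomputable def limN (Q r : ℝ) : ℝ := Q * limW Q r ^ 2 + limI Q r
/-- `φ0·E`. -/
noncomputable def limPhi (Q r : ℝ) : ℝ := 2 * Q * (1 - Q) * r * limW Q r
/-- `E = r(1+Qr)²(Q+r)²`. -/
noncomputable def limE (Q r : ℝ) : ℝ := r * (1 + Q * r) ^ 2 * (Q + r) ^ 2
/-- `μ(r) = min(8/(r+1), 1/2)`. -/
noncomputable def limMu (r : ℝ) : ℝ := min (8 / (r + 1)) (1 / 2)
/-- A-sector numerator. -/
noncomputable def asecF (J0 D0 Q r : ℝ) : ℝ := kap * limN Q r - J0 * limPhi Q r - D0 * limI Q r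
/-- A-half-plane margin `X`. -/
noncomputable def ahpX (J0 D0 Q r : ℝ) : ℝ := limN Q r - J0 * limPhi Q r - D0 * limI Q r
/-- A-half-plane room `64X² − D²·E·N`. -/
noncomputable def ahpF (J0 D0 Q r D : ℝ) : ℝ := 64 * ahpX J0 D0 Q r ^ 2 - D ^ 2 * limE Q r * limN Q r
/-- Ti-half-plane numerator. -/
noncomputable def thpF (g0 Q r p : ℝ) : ℝ := 64 * g0 * (1 - Q) - p * (Q * r + 1) * (Q + r)
/-- the three-read flat law. -/
def MenuFlat3Sig (J0 D0 g0 : ℝ) : Prop :=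
  ∀ Q r : ℝ, 0 ≤ Q → Q ≤ 1 → 1 ≤ r →
    0 ≤ asecF J0 D0 Q r ∨ (0 ≤ ahpX J0 D0 Q r ∧ 0 ≤ ahpF J0 D0 Q r 1) ∨ 0 ≤ thpF g0 Q r (limMu r)
/-- package PH. -/
def MenuFlatPH : Prop := MenuFlat3Sig (9 / 2) 1 (9 / 25)
end FlatDefs

/-! ## §1 The checker (exact unnormalised fractions `num/(pden+1)`) -/

/-- `num/(pden + 1)`. -/
structure Frac where
  num : Int
  pden : Nat

namespace Frac
/-- literal `n/d` for `d ≥ 1`. -/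
def mk' (n : Int) (d : Nat) : Frac := ⟨n, d - 1⟩
/-- the natural number `n` as `n/1`. -/
def ofNat (n : Nat) : Frac := ⟨n, 0⟩
/-- sum (common denominator `(pa+1)(pb+1)`). -/
def add (a b : Frac) : Frac := ⟨a.num * (b.pden + 1 : Nat) + b.num * (a.pden + 1 : Nat), a.pden * b.pden + a.pden + b.pden⟩
/-- difference. -/
def sub (a b : Frac) : Frac := ⟨a.num * (b.pden + 1 : Nat) - b.num * (a.pden + 1 : Nat), a.pden * b.pden + a.pden + b.pden⟩
/-- product. -/
def mul (a b : Frac) : Frac := ⟨a.num * b.num, a.pden * b.pden + a.pden + b.pden⟩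
/-- `a ≤ b` by cross-multiplication (denominators positive). -/
def leB (a b : Frac) : Bool := decide (a.num * (b.pden + 1 : Nat) ≤ b.num * (a.pden + 1 : Nat))
/-- `0 ≤ a`. -/
def nonnegB (a : Frac) : Bool := decide (0 ≤ a.num)
/-- minimum. -/
def min (a b : Frac) : Frac := if a.leB b then a else b
/-- maximum. -/
def max (a b : Frac) : Frac := if a.leB b then b else a
/-- midpoint `(a+b)/2`. -/
def mid (a b : Frac) : Frac := ⟨a.num * (b.pden + 1 : Nat) + b.num * (a.pden + 1 : Nat), 2 * (a.pden * b.pden + a.pden + b.pden) + 1⟩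
/-- `8/(r+1)` if `r ≥ 0` (else `8`). -/
def eightOverSucc (r : Frac) : Frac := ⟨8 * (r.pden + 1 : Nat), r.num.toNat + r.pden⟩
/-- real value. -/
noncomputable def toR (a : Frac) : ℝ := (a.num : ℝ) / ((a.pden : ℝ) + 1)
end Frac

/-- `+` on `Frac`. -/
instance : Add Frac := ⟨Frac.add⟩
/-- `-` on `Frac`. -/
instance : Sub Frac := ⟨Frac.sub⟩
/-- `*` on `Frac`. -/
instance : Mul Frac := ⟨Frac.mul⟩
/-- numerals on `Frac`. -/
instance (n : Nat) : OfNat Frac n := ⟨Frac.ofNat n⟩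

/-- `κ = 27/256`. -/
def kapF : Frac := Frac.mk' 27 256
/-- `g0 = 9/25`. -/
def g0F : Frac := Frac.mk' 9 25
/-- `1/2`. -/
def halfF : Frac := Frac.mk' 1 2
/-- `1/4`. -/
def quarterF : Frac := Frac.mk' 1 4

/-- `W = r² + 1 + 2Qr` on fractions. -/
def Wf (Q r : Frac) : Frac := r * r + 1 + 2 * Q * r
/-- upper bound `min(8/(r1+1), 1/2)` for `μ(r)`, `r ≥ r1`. -/
def muHi (r1 : Frac) : Frac := Frac.min (Frac.eightOverSucc r1) halfF

/-- upper bound for `Q(1 − Q)` on `[Q1, Q2]`. -/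
def qqF (Q1 Q2 : Frac) : Frac :=
  if Q1.leB halfF && halfF.leB Q2 then quarterF else Frac.max (Q1 * (1 - Q1)) (Q2 * (1 - Q2))

/-- one read certified on the CLAMPED box. -/
def leafOK (Q1' Q2' r1' r2 : Frac) : Bool :=
  let Q1 := Frac.max Q1' 0
  let Q2 := Frac.min Q2' 1
  let r1 := Frac.max r1' 1
  let tlo := 64 * g0F * (1 - Q2) - muHi r1 * (Q2 * r2 + 1) * (Q2 + r2)
  tlo.nonnegB ||
  (let Wlo := Wf Q1 r1
   let Whi := Wf Q2 r2
   let Ihi := r2 * (r2 - 1) * (r2 - 1) * (1 - Q1) * (1 - Q1)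
   let qq := qqF Q1 Q2
   let alo := kapF * Q1 * Wlo * Wlo - 9 * qq * r2 * Whi - (1 - kapF) * Ihi
   alo.nonnegB ||
   (let inner := Wlo - 9 * (1 - Q1) * r2
    inner.nonnegB &&
    (let Xlo := Q1 * Wlo * inner
     let Ehi := r2 * ((1 + Q2 * r2) * (1 + Q2 * r2)) * ((Q2 + r2) * (Q2 + r2))
     let Nhi := Q2 * Whi * Whi + Ihi
     (64 * Xlo * Xlo - Ehi * Nhi).nonnegB)))

/-- box inside a proved free region (clamped). -/
def inFree (Q1' Q2' r1' r2 : Frac) : Bool :=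
  let Q1 := Frac.max Q1' 0
  let Q2 := Frac.min Q2' 1
  let r1 := Frac.max r1' 1
  (10 * (1 - Q1)).leB (kapF * Q1 * r1) || (8 * (1 + Q2 * r2)).leB (64 * g0F * (1 - Q2))

/-- branch and bound with fuel. -/
def bb : Nat → Frac → Frac → Frac → Frac → Bool
  | 0, Q1, Q2, r1, r2 => inFree Q1 Q2 r1 r2 || leafOK Q1 Q2 r1 r2
  | d + 1, Q1, Q2, r1, r2 =>
    inFree Q1 Q2 r1 r2 || leafOK Q1 Q2 r1 r2 ||
      (if ((r2 - r1) * 1).leB ((Q2 - Q1) * Frac.max r2 8) && !(((Q2 - Q1) * Frac.max r2 8).leB ((r2 - r1) * 1)) then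
        bb d Q1 (Frac.mid Q1 Q2) r1 r2 && bb d (Frac.mid Q1 Q2) Q2 r1 r2
      else
        bb d Q1 Q2 r1 (Frac.mid r1 r2) && bb d Q1 Q2 (Frac.mid r1 r2) r2)

/-! ## §2 Semantics of the fraction arithmetic (no side conditions: every `Frac` is well formed) -/
namespace Frac

/-- denominators are positive. -/
theorem den_pos (a : Frac) : (0:ℝ) < (a.pden : ℝ) + 1 := by positivity

/-- value of `ofNat`. -/
theorem toR_ofNat (n : Nat) : (Frac.ofNat n).toR = n := by simp [toR, ofNat]

/-- value of a numeral. -/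
@[simp] theorem toR_lit (n : Nat) : Frac.toR (no_index (OfNat.ofNat n : Frac)) = (n : ℝ) := toR_ofNat n

/-- `toR` is additive. -/
@[simp] theorem toR_add (a b : Frac) : (a + b).toR = a.toR + b.toR := by
  show (Frac.add a b).toR = _
  have ha := a.den_pos; have hb := b.den_pos
  simp only [toR, Frac.add]; push_cast
  field_simp; ring

/-- `toR` respects subtraction. -/
@[simp] theorem toR_sub (a b : Frac) : (a - b).toR = a.toR - b.toR := by
  show (Frac.sub a b).toR = _
  have ha := a.den_pos; have hb := b.den_pos
  simp only [toR, Frac.sub]; push_cast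
  field_simp; ring

/-- `toR` is multiplicative. -/
@[simp] theorem toR_mul (a b : Frac) : (a * b).toR = a.toR * b.toR := by
  show (Frac.mul a b).toR = _
  have ha := a.den_pos; have hb := b.den_pos
  simp only [toR, Frac.mul]; push_cast
  field_simp; ring

/-- `leB` decides `≤` of the values. -/
theorem leB_iff (a b : Frac) : a.leB b = true ↔ a.toR ≤ b.toR := by
  have ha := a.den_pos; have hb := b.den_pos
  simp only [leB, decide_eq_true_eq, toR]
  rw [div_le_div_iff₀ ha hb]
  constructor
  · intro h; exact_mod_cast h
  · intro h; exact_mod_cast h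

/-- soundness of `leB`. -/
theorem le_of_leB {a b : Frac} (h : a.leB b = true) : a.toR ≤ b.toR := (leB_iff a b).1 h

/-- soundness of `nonnegB`. -/
theorem nonneg_of_nonnegB {a : Frac} (h : a.nonnegB = true) : 0 ≤ a.toR := by
  simp only [nonnegB, decide_eq_true_eq] at h
  have ha := a.den_pos
  unfold toR; exact div_nonneg (by exact_mod_cast h) ha.le

/-- value of `min`. -/
@[simp] theorem toR_min (a b : Frac) : (Frac.min a b).toR = Min.min a.toR b.toR := by
  unfold Frac.min
  by_cases h : a.leB b = true
  · rw [if_pos h, min_eq_left ((leB_iff a b).1 h)]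
  · rw [if_neg h]
    have : ¬ a.toR ≤ b.toR := fun h' => h ((leB_iff a b).2 h')
    rw [min_eq_right ((not_le.mp this).le)]

/-- value of `max`. -/
@[simp] theorem toR_max (a b : Frac) : (Frac.max a b).toR = Max.max a.toR b.toR := by
  unfold Frac.max
  by_cases h : a.leB b = true
  · rw [if_pos h, max_eq_right ((leB_iff a b).1 h)]
  · rw [if_neg h]
    have : ¬ a.toR ≤ b.toR := fun h' => h ((leB_iff a b).2 h')
    rw [max_eq_left ((not_le.mp this).le)]

/-- value of a literal `n/d`, `d ≥ 1`. -/
theorem toR_mk' (n : Int) {d : Nat} (hd : 1 ≤ d) : (Frac.mk' n d).toR = (n : ℝ) / (d : ℝ) := by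
  simp only [toR, mk']
  congr 1
  have : ((d - 1 : Nat) : ℝ) + 1 = d := by
    rw [Nat.cast_sub hd]; push_cast; ring
  exact this

/-- `8/(r + 1) ≤ eightOverSucc a` whenever `a ≤ r`, `0 ≤ r`. -/
theorem eight_div_le (a : Frac) {r : ℝ} (hr : 0 ≤ r) (har : a.toR ≤ r) :
    8 / (r + 1) ≤ (Frac.eightOverSucc a).toR := by
  have hd := a.den_pos
  simp only [toR, eightOverSucc] at *
  push_cast
  rcases le_or_gt 0 a.num with hn | hn
  · have hcast : ((a.num.toNat : Nat) : ℝ) = (a.num : ℝ) := by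
      have := Int.toNat_of_nonneg hn
      exact_mod_cast this
    rw [hcast]
    have hnum : (0:ℝ) ≤ a.num := by exact_mod_cast hn
    rw [div_le_div_iff₀ (by linarith) (by linarith)]
    rw [div_le_iff₀ hd] at har
    nlinarith
  · have hcast : ((a.num.toNat : Nat) : ℝ) = 0 := by
      have : a.num.toNat = 0 := Int.toNat_of_nonpos hn.le
      exact_mod_cast this
    rw [hcast, zero_add]
    rw [div_le_iff₀ (by linarith)]
    have : 8 * ((a.pden : ℝ) + 1) / ((a.pden : ℝ) + 1) = 8 := by field_simp
    rw [this]; nlinarith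

end Frac

/-- value of `kapF`. -/
@[simp] theorem toR_kapF : kapF.toR = 27 / 256 := by rw [kapF, Frac.toR_mk' _ (by norm_num)]; norm_num
/-- value of `g0F`. -/
@[simp] theorem toR_g0F : g0F.toR = 9 / 25 := by rw [g0F, Frac.toR_mk' _ (by norm_num)]; norm_num
/-- value of `halfF`. -/
@[simp] theorem toR_halfF : halfF.toR = 1 / 2 := by rw [halfF, Frac.toR_mk' _ (by norm_num)]; norm_num
/-- value of `quarterF`. -/
@[simp] theorem toR_quarterF : quarterF.toR = 1 / 4 := by rw [quarterF, Frac.toR_mk' _ (by norm_num)]; norm_num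
/-- value of `Wf`. -/
@[simp] theorem toR_Wf (Q r : Frac) : (Wf Q r).toR = r.toR * r.toR + 1 + 2 * Q.toR * r.toR := by simp [Wf]

/-- `μ(r) ≤ muHi r1` for `r ≥ r1.toR`, `r ≥ 0`. -/
theorem limMu_le_muHi (r1 : Frac) {r : ℝ} (hr : 0 ≤ r) (h : r1.toR ≤ r) : limMu r ≤ (muHi r1).toR := by
  unfold muHi limMu
  rw [Frac.toR_min, toR_halfF]
  exact min_le_min (Frac.eight_div_le r1 hr h) le_rfl

end RhW08.FlatMenuBB
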